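import Summits.MatrixMultiplication.MatrixMultiplication.Theorems.NilpotentLieHostsUnitriangularCostShapeModelRows

/-!
# `UnitriangularCostShape` — Product model, part 7: the level theorem

Crux `stmt-MatrixMultiplication-7724` (`NilpotentLieHosts.UnitriangularCostShape`), line `registered`
(`Cruxes/UnitriangularCostShape/Lines/birth.lean`), stub `stub_productModel` (the Weyl-type product model of
`U(u_d)/I^(s+1)` over the truncated Casimir algebra, `b = k = ⌊d/2⌋`).  Helper vocabulary and lemmas, namespace
`…Theorems.UnitriangularCostShape.ProductModel`.

`level_structure`: the coefficient of `v^{γ_j(β)}` in the level-`j` product `E_j · σ(v^{ε_j(β)})` is a nonzero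
multiple of `x^{shell_j(β)}` plus terms of smaller row-degree (`main_term`, `jsupp_level`).
-/

set_option linter.dupNamespace false

noncomputable section

namespace Summit.MatrixMultiplication.MatrixMultiplication.Theorems.UnitriangularCostShape.ProductModel

open MvPolynomial
open scoped BigOperators Pointwise

variable {d : ℕ}

/-- The variables of column `j`. -/
def LV (j : Fin d) : Finset (Var d) := Finset.univ.filter fun u => u.col = j

/-- The `q`-variables of column `j`. -/
def QV (j : Fin d) : Finset (Var d) := Finset.univ.filter fun u => u.col = j ∧ lo j < u.row

/-- Membership in the variables of column `j`. -/
theorem mem_LV {j : Fin d} {u : Var d} : u ∈ LV j ↔ u.col = j := by simp [LV]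

/-- Membership in the `q`-variables of column `j`. -/
theorem mem_QV {j : Fin d} {u : Var d} : u ∈ QV j ↔ u.col = j ∧ lo j < u.row := by simp [QV]

/-- The exponential factor of level `j`. -/
def EL (K : ℕ) (j : Fin d) : MvPolynomial (Var d) (A d) :=
  ∏ u ∈ LV j, expK K (C (Xmat d u.row u.col) * X u)

/-- The exponential factor of level `j` lies in the level family at `(0, 0)`. -/
theorem jsupp_EL (K : ℕ) (j : Fin d) : JSupp (EL (d := d) K j) ⊆ GR j (0, 0) := by
  unfold EL
  have := jsupp_prod_subset (LV j) (GR j) (gr_add j) (zero_mem_gr j) (a := fun _ => (0, 0))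
    (P := fun u => expK K (C (Xmat d u.row u.col) * X u)) fun u hu =>
      jsupp_expK_factor_subset_gr K j (mem_LV.mp hu)
  simpa using this

/-- Row-degree as a sum over the `q`-variables of column `j`. -/
theorem rhoL_eq_sum (j : Fin d) (β : Fin d × Fin d →₀ ℕ) : rhoL j β = ∑ u ∈ QV j, β (lo j, u.row) := by
  unfold rhoL QV
  rw [Finset.sum_filter]

/-- Weight of the test exponent. -/
theorem weight_epsL (j : Fin d) (β : Fin d × Fin d →₀ ℕ) :
    Finsupp.weight Var.wt (epsL j β) = ∑ u ∈ QV j, β (lo j, u.row) * u.wt := by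
  rw [Finsupp.weight_apply, Finsupp.sum_fintype _ _ (fun _ => by simp)]
  unfold QV
  rw [Finset.sum_filter]
  refine Finset.sum_congr rfl fun u _ => ?_
  rw [epsL_apply]
  split_ifs <;> simp

/-- `σ(v^{ε_j(β)})` as a product of the level decompositions. -/
theorem sigma_monomial_epsL (j : Fin d) (hj : d ≤ 2 * (j : ℕ)) (β : Fin d × Fin d →₀ ℕ) :
    sigma (Xmat d) (monomial (epsL j β) 1) =
      ∏ u ∈ QV j, (Aterm j hj u + Rterm j u) ^ β (lo j, u.row) := by
  classical
  rw [MvPolynomial.monomial_eq, C_1, one_mul,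
    Finsupp.prod_of_support_subset (epsL j β) (s := QV j) ?_ (fun u k => X u ^ k) (fun _ _ => pow_zero _),
    map_prod]
  · refine Finset.prod_congr rfl fun u hu => ?_
    rw [mem_QV] at hu
    rw [map_pow, sigma_X, sigmaX_level j hj hu.1 hu.2, epsL_apply, if_pos hu]
  · intro u hu
    rw [Finsupp.mem_support_iff, epsL_apply] at hu
    rw [mem_QV]
    by_contra h; exact hu (if_neg h)

/-- `σ(v^{ε_j(β)})` lies in the level family at `(wt ε_j(β), ρ_j(β))`. -/
theorem jsupp_sigma_monomial_epsL (j : Fin d) (hj : d ≤ 2 * (j : ℕ)) (β : Fin d × Fin d →₀ ℕ) :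
    JSupp (sigma (Xmat d) (monomial (epsL j β) 1)) ⊆
      GR j (Finsupp.weight Var.wt (epsL j β), rhoL j β) := by
  rw [sigma_monomial_epsL j hj]
  have := jsupp_prod_subset (QV j) (GR j) (gr_add j) (zero_mem_gr j)
    (a := fun u => β (lo j, u.row) • (u.wt, 1))
    (P := fun u => (Aterm j hj u + Rterm j u) ^ β (lo j, u.row)) fun u hu => by
      rw [mem_QV] at hu
      exact jsupp_pow_subset (GR j) (gr_add j) (zero_mem_gr j)
        ((jsupp_add _ _).trans (Set.union_subset (jsupp_Aterm j hj hu.1 hu.2)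
          ((jsupp_Rterm j hu.1).trans (gr_mono j (Nat.zero_le 1))))) _
  have e : (∑ u ∈ QV j, β (lo j, u.row) • ((u.wt, 1) : ℕ × ℕ)) =
      (Finsupp.weight Var.wt (epsL j β), rhoL j β) := by
    rw [weight_epsL, rhoL_eq_sum]
    ext
    · rw [Prod.fst_sum]; simp
    · rw [Prod.snd_sum]; simp
  rw [e] at this
  exact this

/-- Joint support of the level-`j` product. -/
theorem jsupp_level (K : ℕ) (j : Fin d) (hj : d ≤ 2 * (j : ℕ)) (β : Fin d × Fin d →₀ ℕ) :
    JSupp (EL K j * sigma (Xmat d) (monomial (epsL j β) 1)) ⊆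
      GR j (Finsupp.weight Var.wt (epsL j β), rhoL j β) := by
  have := jsupp_mul_subset (GR j) (gr_add j) (jsupp_EL K j) (jsupp_sigma_monomial_epsL j hj β)
  simpa using this

/-- A product of powers of the `A_u` is a monomial in the row variables times a power of the corner variable. -/
theorem prod_Aterm_pow (j : Fin d) (hj : d ≤ 2 * (j : ℕ)) (s : Finset (Var d)) (e : Var d → ℕ) :
    ∏ u ∈ s, (Aterm j hj u) ^ (e u) =
      C (∏ u ∈ s, (X (lo j, u.row) : A d) ^ (e u)) * X (zv j hj) ^ (∑ u ∈ s, e u) := by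
  unfold Aterm
  simp_rw [mul_pow]
  rw [Finset.prod_mul_distrib, map_prod, Finset.prod_pow_eq_pow_sum]
  simp_rw [map_pow]

/-- Column exponent: `v_{(i,j)} ↦ β (i, j)` on column `j`. -/
def colL (j : Fin d) (β : Fin d × Fin d →₀ ℕ) : Var d →₀ ℕ :=
  Finsupp.equivFunOnFinite.symm fun u => if u.col = j then β (u.row, j) else 0

/-- Values of the column exponent. -/
@[simp] theorem colL_apply (j : Fin d) (β : Fin d × Fin d →₀ ℕ) (u : Var d) :
    colL j β u = if u.col = j then β (u.row, j) else 0 := by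
  simp [colL]

/-- The output exponent is the column exponent plus `ρ_j(β)` on the corner. -/
theorem gamL_eq (j : Fin d) (hj : d ≤ 2 * (j : ℕ)) (β : Fin d × Fin d →₀ ℕ) :
    gamL j β = colL j β + Finsupp.single (zv j hj) (rhoL j β) := by
  classical
  ext u
  rw [Finsupp.add_apply, gamL_apply, colL_apply, Finsupp.single_apply]
  by_cases h1 : u.col = j
  · rw [if_pos h1, if_pos h1]
    by_cases h2 : u.row = lo j
    · rw [if_pos h2, if_pos (eq_zv_of_row_eq_lo hj h1 h2).symm]
    · rw [if_neg h2, if_neg]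
      intro h; apply h2; rw [← h]; rfl
  · rw [if_neg h1, if_neg h1, if_neg, add_zero]
    intro h; apply h1; rw [← h]; rfl

/-- A product over the `q`-variables of column `j` as a product over all variables. -/
theorem prod_QV_eq {M : Type*} [CommMonoid M] (j : Fin d) (f : Var d → M) :
    ∏ u ∈ QV j, f u = ∏ u, if u.col = j ∧ lo j < u.row then f u else 1 := by
  unfold QV; rw [Finset.prod_filter]

/-- A product over the variables of column `j` as a product over all variables. -/
theorem prod_LV_eq {M : Type*} [CommMonoid M] (j : Fin d) (f : Var d → M) :
    ∏ u ∈ LV j, f u = ∏ u, if u.col = j then f u else 1 := by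
  unfold LV; rw [Finset.prod_filter]

/-- The main term of the level-`j` product: coefficient of `v^{γ_j(β)}` in `E_j · ∏ A_u^{e_u}`. -/
theorem main_term (K : ℕ) (j : Fin d) (hj : d ≤ 2 * (j : ℕ)) (β : Fin d × Fin d →₀ ℕ)
    (hK : ∀ p, β p < K) :
    coeff (gamL j β) (EL K j * ∏ u ∈ QV j, (Aterm j hj u) ^ β (lo j, u.row)) =
      algebraMap ℚ (A d) (∏ u ∈ LV j, ((β (u.row, j)).factorial : ℚ)⁻¹) * monomial (shellL j β) 1 := by
  classical
  have h1 : ∏ u ∈ QV j, (Aterm j hj u) ^ β (lo j, u.row) =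
      C (∏ u ∈ QV j, (X (lo j, u.row) : A d) ^ β (lo j, u.row)) * X (zv j hj) ^ rhoL j β := by
    rw [prod_Aterm_pow, ← rhoL_eq_sum]
  have h2 : EL K j * (C (∏ u ∈ QV j, (X (lo j, u.row) : A d) ^ β (lo j, u.row)) *
      X (zv j hj) ^ rhoL j β) =
      C (∏ u ∈ QV j, (X (lo j, u.row) : A d) ^ β (lo j, u.row)) *
        (monomial (Finsupp.single (zv j hj) (rhoL j β)) 1 * EL K j) := by
    rw [X_pow_eq_monomial, mul_comm (EL K j), mul_assoc]
  have hle : Finsupp.single (zv j hj) (rhoL j β) ≤ gamL j β := by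
    rw [Finsupp.single_le_iff, gamL_apply, if_pos (zv_col j hj), if_pos (zv_row j hj)]
    exact Nat.le_add_left _ _
  have hδ : gamL j β - Finsupp.single (zv j hj) (rhoL j β) = colL j β := by
    rw [gamL_eq j hj, add_tsub_cancel_right]
  rw [h1, h2, coeff_C_mul, coeff_monomial_mul', if_pos hle, one_mul, hδ]
  unfold EL
  rw [coeff_prod_expK K (LV j) (colL j β)]
  · have e1 : ∏ u ∈ LV j, (algebraMap ℚ (A d) ((colL j β u).factorial : ℚ)⁻¹ *
          Xmat d u.row u.col ^ colL j β u) =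
        ∏ u ∈ LV j, (algebraMap ℚ (A d) ((β (u.row, j)).factorial : ℚ)⁻¹ *
          (X (u.row, j) : A d) ^ β (u.row, j)) := by
      refine Finset.prod_congr rfl fun u hu => ?_
      rw [mem_LV] at hu
      rw [colL_apply, if_pos hu]
      unfold Xmat
      rw [hu]
    rw [e1, Finset.prod_mul_distrib, ← map_prod, mul_left_comm,
      prod_QV_eq j (fun u => (X (lo j, u.row) : A d) ^ β (lo j, u.row)),
      prod_LV_eq j (fun u => (X (u.row, j) : A d) ^ β (u.row, j)), ← monomial_shellL]
  · intro u hu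
    rw [Finsupp.mem_support_iff, colL_apply] at hu
    rw [mem_LV]
    by_contra h; exact hu (if_neg h)
  · intro u; rw [colL_apply]; split_ifs
    · exact hK _
    · exact lt_of_le_of_lt (Nat.zero_le _) (hK (u.row, u.col))

/-- **Level theorem.** The coefficient of `v^{γ_j(β)}` in the level-`j` product
`E_j · σ(v^{ε_j(β)})` is a nonzero multiple of `x^{shell_j(β)}` plus terms of smaller row-degree. -/
theorem level_structure (K : ℕ) (j : Fin d) (hj : d ≤ 2 * (j : ℕ)) (β : Fin d × Fin d →₀ ℕ)
    (hK : ∀ p, β p < K) :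
    ∃ N : A d,
      coeff (gamL j β) (EL K j * sigma (Xmat d) (monomial (epsL j β) 1)) =
        algebraMap ℚ (A d) (∏ u ∈ LV j, ((β (u.row, j)).factorial : ℚ)⁻¹) * monomial (shellL j β) 1 + N ∧
      (∀ b ∈ N.support, rhoL j b < rhoL j β) := by
  classical
  have hA : ∀ u ∈ QV j, JSupp (Aterm j hj u) ⊆ RowLe j 1 := fun u hu =>
    (jsupp_Aterm j hj (mem_QV.mp hu).1 (mem_QV.mp hu).2).trans (gr_subset_rowLe j _ _)
  have hR : ∀ u ∈ QV j, JSupp (Rterm j u) ⊆ RowLe j 0 := fun u hu =>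
    (jsupp_Rterm j (mem_QV.mp hu).1).trans (gr_subset_rowLe j _ _)
  obtain ⟨L, hL, hL'⟩ := prod_expand j (QV j) (Aterm j hj) (Rterm j) (fun u => β (lo j, u.row)) hA hR
  refine ⟨coeff (gamL j β) (EL K j * L), ?_, ?_⟩
  · rw [sigma_monomial_epsL j hj, hL, mul_add, coeff_add, main_term K j hj β hK]
  · intro b hb
    have hEL : JSupp (EL K j) ⊆ RowLe j 0 := (jsupp_EL K j).trans (gr_subset_rowLe j 0 0)
    have := jsupp_mul_rowLe_rowLt j hEL hL' (show (b, gamL j β) ∈ JSupp (EL K j * L) from hb)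
    rw [zero_add, ← rhoL_eq_sum] at this
    exact this

/-- Landing hook of part 7: the level theorem. -/
theorem stub_pm_levelThm : ∀ (d K : ℕ) (j : Fin d), d ≤ 2 * (j : ℕ) → ∀ β : Fin d × Fin d →₀ ℕ, (∀ p, β p < K) → ∃ N : A d, MvPolynomial.coeff (gamL j β) (EL K j * sigma (Xmat d) (MvPolynomial.monomial (epsL j β) 1)) = algebraMap ℚ (A d) (∏ u ∈ LV j, ((β (u.row, j)).factorial : ℚ)⁻¹) * MvPolynomial.monomial (shellL j β) 1 + N ∧ ∀ b ∈ N.support, rhoL j b < rhoL j β :=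
  fun _ K j hj β hK => level_structure K j hj β hK

end Summit.MatrixMultiplication.MatrixMultiplication.Theorems.UnitriangularCostShape.ProductModel
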